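import Summits.NavierStokesRegularity.NavierStokesRegularity.Theses.AxisymmetricExtremality
import Summits.NavierStokesRegularity.NavierStokesRegularity.Theorems.AxisymmetricExtremalityAxisymmetricKatoGlobalStubSeregin2020TypeIILemma22EnergySlice
import Literature.Analysis.FluidPDE.SereginZajaczkowski2007L42VorticityEnergy
import HarnessLib

/-!
# Seregin 2020, Lemma 2.2 (after Nazarov–Uraltseva 2012): moving the Laplacian onto the test
# function in space–time, `∫∫ (ΔΦ) η = ∫∫ Φ Δη`, for `Φ` with `C²` slices on an open set

Helper toward the stub `stub_seregin2020TypeII` of the crux `AxisymmetricKatoGlobal` (= the named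
fact `Literature.Analysis.FluidPDE.Seregin2020_axisymmetricSingularPoint_typeII`, G. Seregin,
Anal. Math. Phys. 10 (2020) Paper 46 = arXiv:2006.04140, Thm 2.1; remaining ingredient Lemma 2.2
in the corrected rendering `hWH′`). In the derivation of the very weak form of (2.12) (Seregin's
displayed inequality, arXiv p. 8 / Nazarov–Uraltseva's (4.5)) the viscous term `-∫∫ ΔΦ η` is the
only one that is moved onto the test function ACROSS the axis: the class 𝒱 has `C^∞` slices with
`∇Φ`, `∂ₑ∂ₑΦ` jointly continuous on the whole regular set `Q₋ ∖ S` (axis points included), so no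
axis cut-off is needed for it. This file records that step for the clauses of `hWH′`:

* `continuousOn_laplacian_slice_of_fderiv_fderiv` — joint continuity of `(t, x) ↦ ΔΦ(t,·)(x)` on
  an open `W` from that of the pure second derivatives `∂ₑ∂ₑΦ` (`Δ = Σᵢ ∂ᵢ∂ᵢ` at `C²` points);
* `integral_laplacian_mul_test_eq` — `∫∫ (ΔΦ) η dx dt = ∫∫ Φ (Δη) dx dt` for `Φ` continuous on
  `W` with `C²` slices, `∇Φ` and `∂ₑ∂ₑΦ` jointly continuous on `W`, and `η` a space–time test
  function on `W` (the tree's slice-wise integration by parts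
  `SereginZajaczkowski2007.integral_mul_fderiv_slice_eq_neg`, twice in every coordinate
  direction, summed).

## References

* G. Seregin, Anal. Math. Phys. 10 (2020), Paper 46 = arXiv:2006.04140, proof of Lemma 2.2
  (arXiv p. 8). [Seregin2020]
* A. I. Nazarov, N. N. Uraltseva, St. Petersburg Math. J. 23 (2012) 93–115 = arXiv:1011.1888,
  §4, (4.5). [NazarovUraltseva2012]
-/

-- the problem directory repeats the summit name (D-0017); core's `dupNamespace` linter fires
set_option linter.dupNamespace false

noncomputable section

open MeasureTheory Set Function Filter Topology TopologicalSpace Metric WithLp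
open scoped NNReal ENNReal InnerProductSpace RealInnerProductSpace Laplacian

namespace Summit.NavierStokesRegularity.NavierStokesRegularity.Theorems.AxisymmetricKatoGlobal.EulerScaling

open Literature.Analysis.FluidPDE Literature.Analysis.FluidPDE.Seregin2020
  Literature.Analysis.FluidPDE.SereginZajaczkowski2007

/-- **Joint continuity of the Laplacian from that of the pure second derivatives.** If the slices
`Φ(t, ·)` are `C²` at the points of an open `W ⊆ ℝ × ℝ³` and every `(t, x) ↦ ∂ₑ∂ₑΦ(t,·)(x)` is
continuous on `W`, then `(t, x) ↦ ΔΦ(t, ·)(x)` is continuous on `W` (`Δ = Σᵢ ∂ᵢ∂ᵢ` in the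
standard basis at `C²` points). [folklore] -/
theorem continuousOn_laplacian_slice_of_fderiv_fderiv {W : Set (ℝ × EuclideanSpace ℝ (Fin 3))}
    {Φ : ℝ → EuclideanSpace ℝ (Fin 3) → ℝ}
    (hΦs : ∀ z ∈ W, ContDiffAt ℝ 2 (Φ z.1) z.2)
    (hΦ2 : ∀ e : EuclideanSpace ℝ (Fin 3), ContinuousOn
      (fun z : ℝ × EuclideanSpace ℝ (Fin 3) => fderiv ℝ (fun y => fderiv ℝ (Φ z.1) y e) z.2 e) W) :
    ContinuousOn (fun z : ℝ × EuclideanSpace ℝ (Fin 3) => Laplacian.laplacian (Φ z.1) z.2) W := by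
  have hsum : ContinuousOn (fun z : ℝ × EuclideanSpace ℝ (Fin 3) =>
      ∑ i, fderiv ℝ (fun y => fderiv ℝ (Φ z.1) y (EuclideanSpace.basisFun (Fin 3) ℝ i)) z.2
        (EuclideanSpace.basisFun (Fin 3) ℝ i)) W :=
    continuousOn_finsetSum _ fun i _ => hΦ2 _
  exact hsum.congr fun z hz => laplacian_eq_sum_of_contDiffAt (hΦs z hz)

/-- **The Laplacian moves onto the test function in space–time.** Let `W ⊆ ℝ × ℝ³` be open,
`Φ` continuous on `W` with `C²` slices at the points of `W`, `(t,x) ↦ ∇Φ(t,·)(x)` and every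
`(t,x) ↦ ∂ₑ∂ₑΦ(t,·)(x)` continuous on `W`, and `η` a space–time test function on `W`. Then
`∫∫ (ΔΦ) η dx dt = ∫∫ Φ (Δη) dx dt` (integrals over `ℝ × ℝ³`): in every coordinate direction
`∫∫ Φ ∂ᵢ∂ᵢη = -∫∫ ∂ᵢΦ ∂ᵢη = ∫∫ (∂ᵢ∂ᵢΦ) η` by the slice-wise integration by parts, and
`Δ = Σᵢ ∂ᵢ∂ᵢ`. In the proof of Lemma 2.2 this is the passage `-∫∫ ΔΦ η ↦ -∫∫ Φ Δη` (equivalently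
`∫∫ ∇Φ·∇η` in Seregin's display), valid across the regular part of the axis where the class 𝒱 is
smooth in `x`. [cite: Seregin2020, proof of Lemma 2.2 (arXiv p. 8), the term ∇π·∇η of the displayed inequality] -/
theorem integral_laplacian_mul_test_eq : ∀ (W : Opens (ℝ × EuclideanSpace ℝ (Fin 3)))
    (Φ : ℝ → EuclideanSpace ℝ (Fin 3) → ℝ),
    ContinuousOn (uncurry Φ) (W : Set (ℝ × EuclideanSpace ℝ (Fin 3))) →
    (∀ z ∈ (W : Set (ℝ × EuclideanSpace ℝ (Fin 3))), ContDiffAt ℝ 2 (Φ z.1) z.2) →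
    ContinuousOn (fun z : ℝ × EuclideanSpace ℝ (Fin 3) => fderiv ℝ (Φ z.1) z.2) (W : Set (ℝ × EuclideanSpace ℝ (Fin 3))) →
    (∀ e : EuclideanSpace ℝ (Fin 3), ContinuousOn
      (fun z : ℝ × EuclideanSpace ℝ (Fin 3) => fderiv ℝ (fun y => fderiv ℝ (Φ z.1) y e) z.2 e)
      (W : Set (ℝ × EuclideanSpace ℝ (Fin 3)))) →
    ∀ (η : ℝ → EuclideanSpace ℝ (Fin 3) → ℝ), IsSpaceTimeTestOn W η →
    ∫ z : ℝ × EuclideanSpace ℝ (Fin 3), Laplacian.laplacian (Φ z.1) z.2 * η z.1 z.2 =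
      ∫ z : ℝ × EuclideanSpace ℝ (Fin 3), Φ z.1 z.2 * Laplacian.laplacian (η z.1) z.2 := by
  intro W Φ hΦc hΦs hΦg hΦ2 η hη
  set e : Fin 3 → EuclideanSpace ℝ (Fin 3) := fun i => EuclideanSpace.basisFun (Fin 3) ℝ i with he
  have hWo : IsOpen (W : Set (ℝ × EuclideanSpace ℝ (Fin 3))) := W.isOpen
  set K : Set (ℝ × EuclideanSpace ℝ (Fin 3)) := tsupport (uncurry η) with hK
  have hKc : IsCompact K := hη.hasCompactSupport
  have hKW : K ⊆ (W : Set (ℝ × EuclideanSpace ℝ (Fin 3))) := hη.tsupport_subset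
  -- the test functions `∂ᵢη`, `∂ᵢ∂ᵢη`
  have hη' : ∀ i, IsSpaceTimeTestOn W (fun t x => fderiv ℝ (η t) x (e i)) := fun i => isSpaceTimeTestOn_fderiv_apply hη (e i)
  have hη'' : ∀ i, IsSpaceTimeTestOn W (fun t x => fderiv ℝ (fun y => fderiv ℝ (η t) y (e i)) x (e i)) := fun i =>
    isSpaceTimeTestOn_fderiv_apply (hη' i) (e i)
  -- continuity / differentiability of `Φ` and `∂ᵢΦ` on `W`
  have cΦ : ContinuousOn (fun z : ℝ × EuclideanSpace ℝ (Fin 3) => Φ z.1 z.2) (W : Set (ℝ × EuclideanSpace ℝ (Fin 3))) := hΦc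
  have dΦ : ∀ z ∈ (W : Set (ℝ × EuclideanSpace ℝ (Fin 3))), DifferentiableAt ℝ (fun y => Φ z.1 y) z.2 := fun z hz =>
    (hΦs z hz).differentiableAt (by norm_num)
  have cΦ' : ∀ i, ContinuousOn (fun z : ℝ × EuclideanSpace ℝ (Fin 3) => fderiv ℝ (fun y => Φ z.1 y) z.2 (e i))
      (W : Set (ℝ × EuclideanSpace ℝ (Fin 3))) := fun i => hΦg.clm_apply continuousOn_const
  have dΦ' : ∀ i, ∀ z ∈ (W : Set (ℝ × EuclideanSpace ℝ (Fin 3))),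
      DifferentiableAt ℝ (fun y => fderiv ℝ (Φ z.1) y (e i)) z.2 := by
    intro i z hz
    have h : ContDiffAt ℝ 1 (fderiv ℝ (Φ z.1)) z.2 := (hΦs z hz).fderiv_right (m := 1) le_rfl
    exact (h.differentiableAt one_ne_zero).clm_apply (differentiableAt_const _)
  -- integrability of the summands
  have iΦη'' : ∀ i, Integrable (fun z : ℝ × EuclideanSpace ℝ (Fin 3) =>
      Φ z.1 z.2 * fderiv ℝ (fun y => fderiv ℝ (η z.1) y (e i)) z.2 (e i)) := fun i => integrable_mul_test cΦ (hη'' i)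
  have iΦ''η : ∀ i, Integrable (fun z : ℝ × EuclideanSpace ℝ (Fin 3) =>
      fderiv ℝ (fun y => fderiv ℝ (Φ z.1) y (e i)) z.2 (e i) * η z.1 z.2) := fun i => integrable_mul_test (hΦ2 (e i)) hη
  -- coordinate by coordinate: twice by parts
  have hcoord : ∀ i, ∫ z : ℝ × EuclideanSpace ℝ (Fin 3), Φ z.1 z.2 * fderiv ℝ (fun y => fderiv ℝ (η z.1) y (e i)) z.2 (e i) =
      ∫ z : ℝ × EuclideanSpace ℝ (Fin 3), fderiv ℝ (fun y => fderiv ℝ (Φ z.1) y (e i)) z.2 (e i) * η z.1 z.2 := by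
    intro i
    have h1 := integral_mul_fderiv_slice_eq_neg (U := W) (g := fun z => Φ z.1 z.2) (v := e i) cΦ dΦ (cΦ' i) (hη' i)
    have h2 := integral_mul_fderiv_slice_eq_neg (U := W) (g := fun z => fderiv ℝ (Φ z.1) z.2 (e i)) (v := e i)
      (cΦ' i) (dΦ' i) (hΦ2 (e i)) hη
    simp only at h1 h2 ⊢
    rw [h1, h2, neg_neg]
  -- `Δ = Σᵢ ∂ᵢ∂ᵢ` for `η` everywhere and for `Φ` on `W`
  have hΔη : ∀ z : ℝ × EuclideanSpace ℝ (Fin 3), (Δ (η z.1)) z.2 = ∑ i, fderiv ℝ (fun y => fderiv ℝ (η z.1) y (e i)) z.2 (e i) :=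
    fun z => laplacian_eq_sum_of_contDiffAt ((hη.contDiff_slice z.1).contDiffAt.of_le (by norm_cast))
  have hΔΦ : ∀ z ∈ (W : Set (ℝ × EuclideanSpace ℝ (Fin 3))),
      (Δ (Φ z.1)) z.2 = ∑ i, fderiv ℝ (fun y => fderiv ℝ (Φ z.1) y (e i)) z.2 (e i) :=
    fun z hz => laplacian_eq_sum_of_contDiffAt (hΦs z hz)
  have hη0 : ∀ z : ℝ × EuclideanSpace ℝ (Fin 3), z ∉ K → η z.1 z.2 = 0 := fun z hz =>
    (image_eq_zero_of_notMem_tsupport hz : uncurry η z = 0)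
  calc ∫ z : ℝ × EuclideanSpace ℝ (Fin 3), (Δ (Φ z.1)) z.2 * η z.1 z.2
      = ∫ z : ℝ × EuclideanSpace ℝ (Fin 3), ∑ i, fderiv ℝ (fun y => fderiv ℝ (Φ z.1) y (e i)) z.2 (e i) * η z.1 z.2 := by
        refine integral_congr_ae (Eventually.of_forall fun z => ?_)
        by_cases hz : z ∈ (W : Set (ℝ × EuclideanSpace ℝ (Fin 3)))
        · simp only [hΔΦ z hz, Finset.sum_mul]
        · simp only [hη0 z (fun h => hz (hKW h)), mul_zero, Finset.sum_const_zero]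
    _ = ∑ i, ∫ z : ℝ × EuclideanSpace ℝ (Fin 3), fderiv ℝ (fun y => fderiv ℝ (Φ z.1) y (e i)) z.2 (e i) * η z.1 z.2 :=
        integral_finsetSum _ fun i _ => iΦ''η i
    _ = ∑ i, ∫ z : ℝ × EuclideanSpace ℝ (Fin 3), Φ z.1 z.2 * fderiv ℝ (fun y => fderiv ℝ (η z.1) y (e i)) z.2 (e i) :=
        Finset.sum_congr rfl fun i _ => (hcoord i).symm
    _ = ∫ z : ℝ × EuclideanSpace ℝ (Fin 3), ∑ i, Φ z.1 z.2 * fderiv ℝ (fun y => fderiv ℝ (η z.1) y (e i)) z.2 (e i) :=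
        (integral_finsetSum _ fun i _ => iΦη'' i).symm
    _ = ∫ z : ℝ × EuclideanSpace ℝ (Fin 3), Φ z.1 z.2 * (Δ (η z.1)) z.2 := by
        refine integral_congr_ae (Eventually.of_forall fun z => ?_)
        simp only [hΔη z, Finset.mul_sum]

end Summit.NavierStokesRegularity.NavierStokesRegularity.Theorems.AxisymmetricKatoGlobal.EulerScaling

end
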